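import Literature.Analysis.FluidPDE.VorticityCalculus
import Literature.Analysis.FluidPDE.BiotSavartNewtonKernel
import Literature.Analysis.FluidPDE.BiotSavartCurlPair
import Summits.NavierStokesRegularity.NavierStokesRegularity.Theorems.ThreadingFluxHorizonTowerZonalFrame
import Summits.NavierStokesRegularity.NavierStokesRegularity.Theorems.ThreadingFluxCentreVirialHodgeDefectShell
import Summits.NavierStokesRegularity.NavierStokesRegularity.Theorems.ThreadingFluxCentreVirialLiouville
import HarnessLib

/-!
# Crux `PoloidalLiouville` (stmt-NavierStokesRegularity-1222, W1), crux idea «centre-virial» (ns-idea-15 g9):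
# ★★ Hodge slaving for `C²` fields (H′, and H″ with vorticity defect), sphere-free

* `Hodge.hodgeSlavingShell_C2`: `u ∈ C²` divergence-free, unthreaded about `x₀`, `0 < a < b` ⇒
  `∫_shell r⁻³|u_tan|² ≤ ½∫_shell (∂_r(r²u_r))²/r⁵`; `Hodge.hodgeSlavingShell_C2_defect` (H″): for EVERY `u ∈ C²`
  divergence-free on the shell, the same with the threading defect `+ ½∫_shell ⟪curl u, y⟫²/r³`.  Sphere-free: the shell
  Bochner inequalities (`…HodgeShell`, `…HodgeDefectShell`) applied to the cut-off tangential part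
  `W = χ(|y|²)(u − (m/|y|²)y)` (`cutTanPart`), with the on-shell identities `|W|²/r³ = tanDensity`, `div W = −D/r²`,
  `⟪curl W, y⟫ = ⟪curl u, y⟫`.
* T2 `poloidalTameLiouville` follows in `ThreadingFluxCentreVirialTame.lean` (T1 + H′ + the card's K4).

Booking (V25-P3): information-grade portrait theorems on the steady decaying stratum; W1 movement 0; T0 / Galdi OPEN;
NS regularity is NOT proved.  `--supports stmt-NavierStokesRegularity-1222 --as helper`.  Filed by ns-wall-eng-4 g6.
[cite: KorobkovPileckasRusso2015, Thm 3.6]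
-/

-- the summit and its single sub-problem share the name (CONVENTIONS §1)
set_option linter.dupNamespace false

noncomputable section

namespace Summit.NavierStokesRegularity.NavierStokesRegularity.Theorems.PoloidalLiouville.CentreVirial

open Set Function MeasureTheory Filter Topology
open Literature.Analysis.FluidPDE
open Literature.Analysis.FluidPDE.VectorCalculus (divergence IsDivFree)
open Summit.NavierStokesRegularity.NavierStokesRegularity.Theorems.PoloidalLiouville.CentreJet
  (E3 IsUnthreadedAbout IsSteadyNSOn)
open scoped RealInnerProductSpace

namespace Hodge

/-! ### Specialisation: the tangential part of a divergence-free unthreaded field -/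

section Spec

/-- The radial coefficient `θ = m/|y|²` and the tangential part `w = u − θ y`. -/
def radCoeff (x₀ : E3) (u : E3 → E3) (z : E3) : ℝ := (‖z - x₀‖ ^ 2)⁻¹ * mom x₀ u z

/-- The tangential part `w = u − (m/|y|²) y` of `u` about `x₀`. -/
def tanPart (x₀ : E3) (u : E3 → E3) (z : E3) : E3 := u z - radCoeff x₀ u z • (z - x₀)

/-- The smooth cut-off of the squared radius: `0` on `(-∞, α/4]`, `1` on `[α/2, ∞)`. -/
def chiCut (α σ : ℝ) : ℝ := Real.smoothTransition (4 / α * (σ - α / 4))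

/-- The cut-off is smooth. -/
theorem chiCut_contDiff (α : ℝ) {n : ℕ∞} : ContDiff ℝ n (chiCut α) :=
  Real.smoothTransition.contDiff.comp (contDiff_const.mul (contDiff_id.sub contDiff_const))

/-- The cut-off vanishes on `(-∞, α/4]`. -/
theorem chiCut_eq_zero {α σ : ℝ} (hα : 0 < α) (h : σ ≤ α / 4) : chiCut α σ = 0 :=
  Real.smoothTransition.zero_of_nonpos (mul_nonpos_of_nonneg_of_nonpos (by positivity) (by linarith))

/-- The cut-off equals `1` on `[α/2, ∞)`. -/
theorem chiCut_eq_one {α σ : ℝ} (hα : 0 < α) (h : α / 2 ≤ σ) : chiCut α σ = 1 := by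
  refine Real.smoothTransition.one_of_one_le ?_
  rw [div_mul_eq_mul_div, le_div_iff₀ hα]
  linarith

/-- The cut-off tangential part `W = χ(|y|²) w`. -/
def cutTanPart (x₀ : E3) (u : E3 → E3) (α : ℝ) (z : E3) : E3 := chiCut α (‖z - x₀‖ ^ 2) • tanPart x₀ u z

variable {u : E3 → E3} {x₀ : E3}

/-- `m` is `C²` when `u` is. -/
theorem contDiff_mom_two (hu : ContDiff ℝ 2 u) : ContDiff ℝ 2 (mom x₀ u) := by
  unfold mom
  exact (contDiff_id.sub contDiff_const).inner ℝ hu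

/-- `θ = m/|y|²` is `C²` off the centre. -/
theorem contDiffOn_radCoeff (hu : ContDiff ℝ 2 u) : ContDiffOn ℝ 2 (radCoeff x₀ u) {x₀}ᶜ := by
  unfold radCoeff
  refine (ContDiff.contDiffOn ?_ |>.inv fun z hz => ?_).mul (contDiff_mom_two hu).contDiffOn
  · exact (contDiff_id.sub contDiff_const).norm_sq ℝ
  · exact pow_ne_zero 2 (norm_ne_zero_iff.2 (sub_ne_zero.2 hz))

/-- `w` is `C²` off the centre. -/
theorem contDiffOn_tanPart (hu : ContDiff ℝ 2 u) : ContDiffOn ℝ 2 (tanPart x₀ u) {x₀}ᶜ := by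
  unfold tanPart
  exact hu.contDiffOn.sub ((contDiffOn_radCoeff hu).smul (contDiff_id.sub contDiff_const).contDiffOn)

/-- `W = χ(|y|²) w` is `C²` everywhere. -/
theorem contDiff_cutTanPart (hu : ContDiff ℝ 2 u) {a : ℝ} (ha : 0 < a) : ContDiff ℝ 2 (cutTanPart x₀ u (a ^ 2)) := by
  have hα : 0 < a ^ 2 := by positivity
  refine contDiff_smul_of_vanishing (ρ := a / 2) (by positivity)
    ((chiCut_contDiff (a ^ 2)).comp ((contDiff_id.sub contDiff_const).norm_sq ℝ)) (fun x hx => ?_) (contDiffOn_tanPart hu)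
  rw [Metric.mem_ball, dist_eq_norm] at hx
  refine chiCut_eq_zero hα ?_
  have h0 : 0 ≤ ‖x - x₀‖ := norm_nonneg _
  nlinarith

/-- `⟪w, y⟫ = 0`. -/
theorem inner_tanPart (u : E3 → E3) (x₀ z : E3) : ⟪tanPart x₀ u z, z - x₀⟫ = 0 := by
  unfold tanPart radCoeff mom
  rw [inner_sub_left, real_inner_smul_left, real_inner_self_eq_norm_sq, real_inner_comm (z - x₀) (u z)]
  by_cases h : ‖z - x₀‖ ^ 2 = 0
  · have hz : z - x₀ = 0 := by
      have := pow_eq_zero_iff (n := 2) (two_ne_zero) |>.1 h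
      exact norm_eq_zero.1 this
    simp [hz]
  · have h' : ‖z - x₀‖ ≠ 0 := fun e => h (by rw [e]; ring)
    field_simp
    ring

/-- `⟪W, y⟫ = 0`. -/
theorem inner_cutTanPart (u : E3 → E3) (x₀ : E3) (α : ℝ) (z : E3) : ⟪cutTanPart x₀ u α z, z - x₀⟫ = 0 := by
  unfold cutTanPart
  rw [real_inner_smul_left, inner_tanPart, mul_zero]

/-- `⟪(c y) × v, y⟫ = 0`: the rank-one curl terms are orthogonal to `y`. -/
theorem inner_cross_smul_left_self (c : ℝ) (y v : E3) : ⟪cross (c • y) v, y⟫ = 0 := by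
  simp only [cross, PiLp.inner_apply, cross_apply, RCLike.inner_apply, conj_trivial, PiLp.smul_apply, smul_eq_mul,
    Fin.sum_univ_three, Matrix.cons_val_zero, Matrix.cons_val_one, Matrix.cons_val_two,
    Matrix.head_cons, Matrix.tail_cons]
  ring

/-- The gradient of a radial profile of the squared radius: `∇(κ(|y|²)) = 2κ′(|y|²) y`. -/
theorem gradient_radialProfile {κ : ℝ → ℝ} (hκ : ContDiff ℝ 1 κ) (x₀ x : E3) :
    gradient (fun z : E3 => κ (‖z - x₀‖ ^ 2)) x = (2 * deriv κ (‖x - x₀‖ ^ 2)) • (x - x₀) := by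
  have h1 : HasFDerivAt (fun x : E3 => x - x₀) (ContinuousLinearMap.id ℝ E3) x := (hasFDerivAt_id x).sub_const x₀
  have h2 := h1.norm_sq
  have h3 : HasDerivAt κ (deriv κ (‖x - x₀‖ ^ 2)) (‖x - x₀‖ ^ 2) := (hκ.differentiable one_ne_zero _).hasDerivAt
  have h4 := h3.comp_hasFDerivAt x h2
  have e : (fun z : E3 => κ (‖z - x₀‖ ^ 2)) = κ ∘ fun x : E3 => ‖x - x₀‖ ^ 2 := rfl
  rw [gradient, e, h4.fderiv]
  apply (InnerProductSpace.toDual ℝ E3).injective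
  rw [LinearIsometryEquiv.apply_symm_apply]
  ext h
  simp only [_root_.FunLike.coe_smul, Pi.smul_apply, ContinuousLinearMap.comp_apply, ContinuousLinearMap.id_apply,
    innerSL_apply_apply, smul_eq_mul, InnerProductSpace.toDual_apply_apply, real_inner_smul_left]
  ring

/-- `curl (y ↦ y − x₀) = 0`. -/
theorem curl_sub_const_self (x₀ z : E3) : curl (fun y : E3 => y - x₀) z = 0 := by
  rw [curl_eq_curlCLM, fderiv_sub_const, fderiv_fun_id, curlCLM_apply]
  ext i
  fin_cases i <;> simp

/-- The radial coefficient and the tangential part are differentiable off the centre. -/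
theorem differentiableAt_radCoeff (hu : ContDiff ℝ 2 u) {z : E3} (hz : z ≠ x₀) :
    DifferentiableAt ℝ (radCoeff x₀ u) z :=
  ((contDiffOn_radCoeff hu).contDiffAt (isOpen_compl_singleton.mem_nhds hz)).differentiableAt (by simp)

/-- `w` is differentiable off the centre. -/
theorem differentiableAt_tanPart (hu : ContDiff ℝ 2 u) {z : E3} (hz : z ≠ x₀) :
    DifferentiableAt ℝ (tanPart x₀ u) z :=
  ((contDiffOn_tanPart hu).contDiffAt (isOpen_compl_singleton.mem_nhds hz)).differentiableAt (by simp)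

/-- `⟪curl w, y⟫ = ⟪curl u, y⟫` off the centre (the radial correction `(m/|y|²) y` has curl `∇θ × y ⊥ y`). -/
theorem inner_curl_tanPart_eq (hu : ContDiff ℝ 2 u) {z : E3} (hz : z ≠ x₀) :
    ⟪curl (tanPart x₀ u) z, z - x₀⟫ = ⟪curl u z, z - x₀⟫ := by
  have hud : DifferentiableAt ℝ u z := hu.differentiable (by norm_num) z
  have hθd := differentiableAt_radCoeff hu hz
  have hyd : DifferentiableAt ℝ (fun y : E3 => y - x₀) z := differentiableAt_id.sub_const x₀
  have e : tanPart x₀ u = fun y => u y - radCoeff x₀ u y • (y - x₀) := rfl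
  have H2 : DifferentiableAt ℝ (fun y => radCoeff x₀ u y • (y - x₀)) z := hθd.smul hyd
  rw [e, curl_sub hud H2, curl_smul hθd hyd, curl_sub_const_self, smul_zero, zero_add,
    fderiv_eq_innerSL_gradient, curlCLM_smulRight_innerSL, inner_sub_left, HorizonTower.Zonal.inner_cross_self_right, sub_zero]

/-- `w` is unthreaded off the centre when `u` is. -/
theorem inner_curl_tanPart (hu : ContDiff ℝ 2 u) (hunthr : ∀ x, ⟪x - x₀, curl u x⟫ = 0) {z : E3} (hz : z ≠ x₀) :
    ⟪curl (tanPart x₀ u) z, z - x₀⟫ = 0 := by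
  have hud : DifferentiableAt ℝ u z := hu.differentiable (by norm_num) z
  have hθd := differentiableAt_radCoeff hu hz
  have hyd : DifferentiableAt ℝ (fun y : E3 => y - x₀) z := differentiableAt_id.sub_const x₀
  have e : tanPart x₀ u = fun y => u y - radCoeff x₀ u y • (y - x₀) := rfl
  have H2 : DifferentiableAt ℝ (fun y => radCoeff x₀ u y • (y - x₀)) z := hθd.smul hyd
  rw [e, curl_sub hud H2, curl_smul hθd hyd, curl_sub_const_self, smul_zero, zero_add,
    fderiv_eq_innerSL_gradient, curlCLM_smulRight_innerSL, inner_sub_left, HorizonTower.Zonal.inner_cross_self_right, sub_zero,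
    real_inner_comm]
  exact hunthr z

/-- `W = χ(|y|²) w` is unthreaded off the centre. -/
theorem inner_curl_cutTanPart (hu : ContDiff ℝ 2 u) (hunthr : ∀ x, ⟪x - x₀, curl u x⟫ = 0) (a : ℝ)
    {z : E3} (hz : z ≠ x₀) : ⟪curl (cutTanPart x₀ u (a ^ 2)) z, z - x₀⟫ = 0 := by
  have hg : ContDiff ℝ 1 fun y : E3 => chiCut (a ^ 2) (‖y - x₀‖ ^ 2) :=
    (chiCut_contDiff (a ^ 2)).comp ((contDiff_id.sub contDiff_const).norm_sq ℝ)
  have hgd : DifferentiableAt ℝ (fun y : E3 => chiCut (a ^ 2) (‖y - x₀‖ ^ 2)) z := hg.differentiable one_ne_zero z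
  have hwd := differentiableAt_tanPart hu hz
  have e : cutTanPart x₀ u (a ^ 2) = fun y => chiCut (a ^ 2) (‖y - x₀‖ ^ 2) • tanPart x₀ u y := rfl
  rw [e, curl_smul hgd hwd, inner_add_left, real_inner_smul_left, inner_curl_tanPart hu hunthr hz, mul_zero, zero_add,
    fderiv_eq_innerSL_gradient, curlCLM_smulRight_innerSL, gradient_radialProfile (chiCut_contDiff (a ^ 2))]
  exact inner_cross_smul_left_self _ _ _

/-- On the open set `{|y|² > α/2}` the cut-off is inactive. -/
theorem cutTanPart_eventuallyEq {α : ℝ} (hα : 0 < α) {x : E3} (hx : α / 2 < ‖x - x₀‖ ^ 2) :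
    cutTanPart x₀ u α =ᶠ[𝓝 x] tanPart x₀ u := by
  have hopen : IsOpen {z : E3 | α / 2 < ‖z - x₀‖ ^ 2} :=
    isOpen_lt continuous_const ((continuous_norm.comp (continuous_id.sub continuous_const)).pow 2)
  refine Filter.eventuallyEq_of_mem (hopen.mem_nhds hx) fun z hz => ?_
  show chiCut α (‖z - x₀‖ ^ 2) • tanPart x₀ u z = tanPart x₀ u z
  rw [chiCut_eq_one hα (le_of_lt hz), one_smul]

/-- `div w = −D/|y|²` off the centre for divergence-free `u` (`D = ∂_r(r²u_r)` = `radialFluxDeriv`). -/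
theorem divergence_tanPart (hu : ContDiff ℝ 2 u) {z : E3} (hdiv : divergence u z = 0) (hz : z ≠ x₀) :
    divergence (tanPart x₀ u) z = -(radialFluxDeriv x₀ u z) / ‖z - x₀‖ ^ 2 := by
  have hn : ‖z - x₀‖ ^ 2 ≠ 0 := pow_ne_zero 2 (norm_ne_zero_iff.2 (sub_ne_zero.2 hz))
  have hud : DifferentiableAt ℝ u z := hu.differentiable (by norm_num) z
  have hθd := differentiableAt_radCoeff hu hz
  have hyd : DifferentiableAt ℝ (fun y : E3 => y - x₀) z := differentiableAt_id.sub_const x₀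
  have hmd : DifferentiableAt ℝ (mom x₀ u) z := (contDiff_mom_two hu).differentiable (by norm_num) z
  -- derivative of the radial coefficient along `y`
  have h1 : HasFDerivAt (fun x : E3 => x - x₀) (ContinuousLinearMap.id ℝ E3) z := (hasFDerivAt_id z).sub_const x₀
  have h3 := (hasDerivAt_inv hn).comp_hasFDerivAt z h1.norm_sq
  have h5' := h3.mul hmd.hasFDerivAt
  have h5 : HasFDerivAt (radCoeff x₀ u)
      ((‖z - x₀‖ ^ 2)⁻¹ • fderiv ℝ (mom x₀ u) z +
        mom x₀ u z • (-((‖z - x₀‖ ^ 2) ^ 2)⁻¹ • ((2 : ℕ) • (innerSL ℝ (z - x₀)).comp (ContinuousLinearMap.id ℝ E3)))) z :=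
    h5'
  have hsub : ∀ f g : E3 → E3, DifferentiableAt ℝ f z → DifferentiableAt ℝ g z →
      divergence (fun y => f y - g y) z = divergence f z - divergence g z := by
    intro f g hf hg
    unfold VectorCalculus.divergence
    rw [fderiv_fun_sub hf hg, ContinuousLinearMap.toLinearMap_sub, map_sub]
  have hdiv3 : divergence (fun y : E3 => y - x₀) z = 3 := by
    unfold VectorCalculus.divergence
    rw [fderiv_sub_const, fderiv_fun_id]
    have ht := LinearMap.trace_id ℝ E3
    rw [finrank_euclideanSpace_fin] at ht
    exact_mod_cast ht
  have e : tanPart x₀ u = fun y => u y - radCoeff x₀ u y • (y - x₀) := rfl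
  have H2 : DifferentiableAt ℝ (fun y => radCoeff x₀ u y • (y - x₀)) z := hθd.smul hyd
  rw [e, hsub _ _ hud H2, hdiv, divergence_smul_apply hθd hyd, hdiv3, ← real_inner_comm, gradient,
    InnerProductSpace.toDual_symm_apply, h5.fderiv]
  simp only [_root_.add_apply, _root_.smul_apply, smul_eq_mul, ContinuousLinearMap.comp_apply,
    ContinuousLinearMap.id_apply, innerSL_apply_apply, real_inner_self_eq_norm_sq]
  have hr : ‖z - x₀‖ ≠ 0 := norm_ne_zero_iff.2 (sub_ne_zero.2 hz)
  unfold radialFluxDeriv radCoeff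
  field_simp
  ring

/-- `|w|² = (|y|²|u|² − m²)/|y|²` off the centre. -/
theorem norm_tanPart_sq (u : E3 → E3) {z : E3} (hz : z ≠ x₀) :
    ‖tanPart x₀ u z‖ ^ 2 = (‖z - x₀‖ ^ 2 * ‖u z‖ ^ 2 - mom x₀ u z ^ 2) / ‖z - x₀‖ ^ 2 := by
  have hr : ‖z - x₀‖ ≠ 0 := norm_ne_zero_iff.2 (sub_ne_zero.2 hz)
  unfold tanPart radCoeff
  rw [norm_sub_sq_real, real_inner_smul_right, norm_smul, mul_pow, Real.norm_eq_abs, sq_abs,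
    real_inner_comm (z - x₀) (u z)]
  unfold mom
  field_simp
  ring

/-- ★★ **Hodge slaving for `C²` fields (H′), sphere-free.**  If `u ∈ C²(ℝ³; ℝ³)` is divergence-free and unthreaded
about `x₀` (`⟪x − x₀, curl u x⟫ = 0`), then on every shell `0 < a < |y| < b`:
`∫_shell r⁻³|u_tan|² ≤ ½ ∫_shell (∂_r(r²u_r))²/r⁵` — the card's `HodgeSlavingShell` with the binder `C²` in place of `C¹`. -/
theorem hodgeSlavingShell_C2 (u : E3 → E3) (x₀ : E3) (a b : ℝ) (hu : ContDiff ℝ 2 u)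
    (hdiv : ∀ x, divergence u x = 0) (hunthr : ∀ x, ⟪x - x₀, curl u x⟫ = 0) (ha : 0 < a) (hab : a < b) :
    ∫ x in shell x₀ a b, tanDensity x₀ u x ≤
      (1 / 2) * ∫ x in shell x₀ a b, radialFluxDeriv x₀ u x ^ 2 / ‖x - x₀‖ ^ 5 := by
  have hα : 0 < a ^ 2 := by positivity
  set W := cutTanPart x₀ u (a ^ 2) with hW_def
  have hW : ContDiff ℝ 2 W := contDiff_cutTanPart hu ha
  have htan : ∀ z, ⟪W z, z - x₀⟫ = 0 := fun z => inner_cutTanPart u x₀ _ z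
  have hcurl : ∀ z, z ≠ x₀ → ⟪curl W z, z - x₀⟫ = 0 := fun z hz => inner_curl_cutTanPart hu hunthr a hz
  have key := shell_bochner_ineq hW htan hcurl ha hab
  have hshell : shell x₀ a b = {x | a < ‖x - x₀‖ ∧ ‖x - x₀‖ < b} := rfl
  -- on the shell, `W = w` near each point
  have hon : ∀ x ∈ shell x₀ a b, x ≠ x₀ ∧ (W =ᶠ[𝓝 x] tanPart x₀ u) := by
    intro x hx
    have hr : a < ‖x - x₀‖ := hx.1
    refine ⟨fun h => ?_, cutTanPart_eventuallyEq hα ?_⟩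
    · rw [h, sub_self, norm_zero] at hr; linarith
    · have : a ^ 2 < ‖x - x₀‖ ^ 2 := pow_lt_pow_left₀ hr ha.le two_ne_zero
      linarith
  have e1 : ∫ x in shell x₀ a b, ‖W x‖ ^ 2 / ‖x - x₀‖ ^ 3 = ∫ x in shell x₀ a b, tanDensity x₀ u x := by
    refine setIntegral_congr_fun (measurableSet_shell x₀ a b) fun x hx => ?_
    obtain ⟨hx0, hev⟩ := hon x hx
    have hr : ‖x - x₀‖ ≠ 0 := norm_ne_zero_iff.2 (sub_ne_zero.2 hx0)
    show ‖W x‖ ^ 2 / ‖x - x₀‖ ^ 3 = tanDensity x₀ u x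
    rw [hev.eq_of_nhds, norm_tanPart_sq u hx0]
    unfold tanDensity
    field_simp
  have e2 : ∫ x in shell x₀ a b, divergence W x ^ 2 / ‖x - x₀‖ =
      ∫ x in shell x₀ a b, radialFluxDeriv x₀ u x ^ 2 / ‖x - x₀‖ ^ 5 := by
    refine setIntegral_congr_fun (measurableSet_shell x₀ a b) fun x hx => ?_
    obtain ⟨hx0, hev⟩ := hon x hx
    have hr : ‖x - x₀‖ ≠ 0 := norm_ne_zero_iff.2 (sub_ne_zero.2 hx0)
    show divergence W x ^ 2 / ‖x - x₀‖ = radialFluxDeriv x₀ u x ^ 2 / ‖x - x₀‖ ^ 5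
    have hd : divergence W x = divergence (tanPart x₀ u) x := by
      unfold VectorCalculus.divergence
      rw [hev.fderiv_eq]
    rw [hd, divergence_tanPart hu (hdiv x) hx0]
    field_simp
  rw [hshell] at e1 e2
  rw [e1, e2] at key
  exact key

/-- ★★ **Hodge slaving with vorticity defect, for `C²` fields, sphere-free (H″).**  For EVERY `u ∈ C²(ℝ³; ℝ³)` that
is divergence-free on the shell `a < |x − x₀| < b` (`0 < a`):
`∫_shell r⁻³|u_tan|² ≤ ½∫_shell (∂_r(r²u_r))²/r⁵ + ½∫_shell ⟪curl u, x − x₀⟫²/r³` — no unthreadedness assumed; the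
extra term is the threading through the spheres and vanishes exactly on unthreaded fields. -/
theorem hodgeSlavingShell_C2_defect (u : E3 → E3) (x₀ : E3) (a b : ℝ) (hu : ContDiff ℝ 2 u)
    (hdiv : ∀ x ∈ shell x₀ a b, divergence u x = 0) (ha : 0 < a) (hab : a < b) :
    ∫ x in shell x₀ a b, tanDensity x₀ u x ≤
      ((1 / 2) * ∫ x in shell x₀ a b, radialFluxDeriv x₀ u x ^ 2 / ‖x - x₀‖ ^ 5) +
        (1 / 2) * ∫ x in shell x₀ a b, ⟪curl u x, x - x₀⟫ ^ 2 / ‖x - x₀‖ ^ 3 := by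
  have hα : 0 < a ^ 2 := by positivity
  set W := cutTanPart x₀ u (a ^ 2) with hW_def
  have hW : ContDiff ℝ 2 W := contDiff_cutTanPart hu ha
  have htan : ∀ z, ⟪W z, z - x₀⟫ = 0 := fun z => inner_cutTanPart u x₀ _ z
  have key := shell_bochner_ineq_defect hW htan ha hab
  have hshell : shell x₀ a b = {x | a < ‖x - x₀‖ ∧ ‖x - x₀‖ < b} := rfl
  have hon : ∀ x ∈ shell x₀ a b, x ≠ x₀ ∧ (W =ᶠ[𝓝 x] tanPart x₀ u) := by
    intro x hx
    have hr : a < ‖x - x₀‖ := hx.1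
    refine ⟨fun h => ?_, cutTanPart_eventuallyEq hα ?_⟩
    · rw [h, sub_self, norm_zero] at hr; linarith
    · have : a ^ 2 < ‖x - x₀‖ ^ 2 := pow_lt_pow_left₀ hr ha.le two_ne_zero
      linarith
  have e1 : ∫ x in shell x₀ a b, ‖W x‖ ^ 2 / ‖x - x₀‖ ^ 3 = ∫ x in shell x₀ a b, tanDensity x₀ u x := by
    refine setIntegral_congr_fun (measurableSet_shell x₀ a b) fun x hx => ?_
    obtain ⟨hx0, hev⟩ := hon x hx
    have hr : ‖x - x₀‖ ≠ 0 := norm_ne_zero_iff.2 (sub_ne_zero.2 hx0)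
    show ‖W x‖ ^ 2 / ‖x - x₀‖ ^ 3 = tanDensity x₀ u x
    rw [hev.eq_of_nhds, norm_tanPart_sq u hx0]
    unfold tanDensity
    field_simp
  have e2 : ∫ x in shell x₀ a b, divergence W x ^ 2 / ‖x - x₀‖ =
      ∫ x in shell x₀ a b, radialFluxDeriv x₀ u x ^ 2 / ‖x - x₀‖ ^ 5 := by
    refine setIntegral_congr_fun (measurableSet_shell x₀ a b) fun x hx => ?_
    obtain ⟨hx0, hev⟩ := hon x hx
    have hr : ‖x - x₀‖ ≠ 0 := norm_ne_zero_iff.2 (sub_ne_zero.2 hx0)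
    show divergence W x ^ 2 / ‖x - x₀‖ = radialFluxDeriv x₀ u x ^ 2 / ‖x - x₀‖ ^ 5
    have hd : divergence W x = divergence (tanPart x₀ u) x := by
      unfold VectorCalculus.divergence
      rw [hev.fderiv_eq]
    rw [hd, divergence_tanPart hu (hdiv x hx) hx0]
    field_simp
  have e3 : ∫ x in shell x₀ a b, ⟪curl W x, x - x₀⟫ ^ 2 / ‖x - x₀‖ ^ 3 =
      ∫ x in shell x₀ a b, ⟪curl u x, x - x₀⟫ ^ 2 / ‖x - x₀‖ ^ 3 := by
    refine setIntegral_congr_fun (measurableSet_shell x₀ a b) fun x hx => ?_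
    obtain ⟨hx0, hev⟩ := hon x hx
    show ⟪curl W x, x - x₀⟫ ^ 2 / ‖x - x₀‖ ^ 3 = ⟪curl u x, x - x₀⟫ ^ 2 / ‖x - x₀‖ ^ 3
    have hc : curl W x = curl (tanPart x₀ u) x := by
      rw [curl_eq_curlCLM, curl_eq_curlCLM, hev.fderiv_eq]
    rw [hc, inner_curl_tanPart_eq hu hx0]
  rw [hshell] at e1 e2 e3
  rw [e1, e2, e3] at key
  exact key

end Spec


end Hodge


end Summit.NavierStokesRegularity.NavierStokesRegularity.Theorems.PoloidalLiouville.CentreVirial
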